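import Summits.Ventures.GridStability.Models.StructurePreservingPhase
import Literature.Analysis.ODE.LipschitzFlow

/-!
# GridStability/Models/StructurePreservingGlobal — the structure-preserving phase field is globally
# Lipschitz: every phase point has a solution for all times (existence companion of the a-priori
# region-of-attraction sentences)

LADDER-GRIDFUSION G3 (model register), seat gridfusion-model-2 (g5); `plan/MODEL-VALIDITY.md` row
**MV-3**. Companion of `StructurePreservingPhase.lean` (model-2's `Params.phaseField`, the
Bergen–Hill model [cite: Padiyar2013, §3.2 eq (3.2)]; [cite: BergenHill1981] as an autonomous field
on `(Fin n → ℝ) × (Fin n → ℝ)`). The tree's region-of-attraction sentences for MODEL MV-3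
(`Lyapunov/StructurePreservingRoa.lean`, `Models/StructurePreservingLurieRoa.lean`) are A PRIORI:
they quantify over all solutions from a state. This file supplies the existence half ONCE for every
state and every parameter set: the field is globally Lipschitz (the couplings enter through `sin`,
everything else is linear), so the tree's global-existence theorem for Lipschitz fields
(`Literature.Analysis.ODE.exists_solution_real_of_lipschitz`, [cite: Hartman2002, Ch. III Thm. 5.1
with Remark 1]) gives a solution through every phase point, defined for all `t ∈ ℝ`.

## Contents (all PROVED; no well-formedness hypothesis is needed — Lean's `x / 0 = 0` makes the
constants below valid for arbitrary data)
* `absCoupling p i = Σⱼ |bᵢⱼ|`, `abs_pe_sub_pe_le` — `|fᵢ(δ) − fᵢ(δ')| ≤ 2·(Σⱼ|bᵢⱼ|)·dist(δ, δ')`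
  (`|sin a − sin b| ≤ |a − b|`);
* `lipConst p`, `dist_phaseField_le`, `lipschitzWith_phaseField` — an explicit global Lipschitz
  constant of `p.phaseField` (sup metric of the phase space);
* `exists_phaseSolution` — **through every phase point passes a solution of MV-3 defined on all of
  `ℝ`**; `exists_phaseSolution_Icc` — the same in the tree's `[0, T]` convention (the shape the
  region-of-attraction theorems quantify over); `phaseSolution_unique` — and only one (Grönwall).
MODELLED column only (model MV-3); nothing here is a certificate or a statement about a grid.
-/

noncomputable section

open Finset Real Set

namespace Summit.Ventures.GridStability.Models.StructurePreserving.Params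

variable {n : ℕ}

/-! ## The injections are Lipschitz in the bus angles -/

/-- Row sum of the absolute couplings at bus `i`: `Σⱼ |bᵢⱼ|`. -/
def absCoupling (p : Params n) (i : Fin n) : ℝ := ∑ j, |p.b i j|

/-- `absCoupling` is nonnegative. -/
theorem absCoupling_nonneg (p : Params n) (i : Fin n) : 0 ≤ p.absCoupling i :=
  Finset.sum_nonneg fun _ _ => abs_nonneg _

/-- **The injections are Lipschitz in the angles**: `|fᵢ(δ) − fᵢ(δ')| ≤ 2·(Σⱼ|bᵢⱼ|)·dist(δ, δ')`
(each branch term moves by at most `|bᵢⱼ|·|(δᵢ − δⱼ) − (δ'ᵢ − δ'ⱼ)| ≤ 2|bᵢⱼ|·dist(δ, δ')`, by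
`|sin a − sin b| ≤ |a − b|`). [cite: Padiyar2013, §3.2 eq (3.9)] -/
theorem abs_pe_sub_pe_le (p : Params n) (δ δ' : Fin n → ℝ) (i : Fin n) :
    |p.pe δ i - p.pe δ' i| ≤ 2 * p.absCoupling i * dist δ δ' := by
  have hd : ∀ j, |δ j - δ' j| ≤ dist δ δ' := fun j => by
    rw [← Real.dist_eq]; exact dist_le_pi_dist δ δ' j
  have hsub : p.pe δ i - p.pe δ' i
      = ∑ j, p.b i j * (Real.sin (δ i - δ j) - Real.sin (δ' i - δ' j)) := by
    simp only [pe, ← Finset.sum_sub_distrib, mul_sub]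
  rw [hsub, absCoupling, Finset.mul_sum, Finset.sum_mul]
  refine (Finset.abs_sum_le_sum_abs _ _).trans (Finset.sum_le_sum fun j _ => ?_)
  rw [abs_mul]
  have h1 : |Real.sin (δ i - δ j) - Real.sin (δ' i - δ' j)| ≤ |(δ i - δ j) - (δ' i - δ' j)| :=
    Real.abs_sin_sub_sin_le _ _
  have h2 : |(δ i - δ j) - (δ' i - δ' j)| ≤ |δ i - δ' i| + |δ j - δ' j| := by
    rw [show (δ i - δ j) - (δ' i - δ' j) = (δ i - δ' i) - (δ j - δ' j) by ring]
    exact abs_sub _ _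
  have h3 : |δ i - δ' i| + |δ j - δ' j| ≤ 2 * dist δ δ' := by linarith [hd i, hd j]
  calc |p.b i j| * |Real.sin (δ i - δ j) - Real.sin (δ' i - δ' j)|
      ≤ |p.b i j| * (2 * dist δ δ') :=
        mul_le_mul_of_nonneg_left (h1.trans (h2.trans h3)) (abs_nonneg _)
    _ = 2 * |p.b i j| * dist δ δ' := by ring

/-! ## A global Lipschitz constant of the phase field -/

/-- An explicit global Lipschitz constant of `p.phaseField` for the sup metric:
`1 + Σᵢ (2Aᵢ/|Dᵢ| + (|Dᵢ| + 2Aᵢ)/|Mᵢ|)`, `Aᵢ = Σⱼ|bᵢⱼ|` (terms with a zero denominator are `0`,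
matching the field, whose corresponding component is then constant). -/
def lipConst (p : Params n) : ℝ :=
  1 + ∑ i, (2 * p.absCoupling i / |p.D i| + (|p.D i| + 2 * p.absCoupling i) / |p.M i|)

/-- The summands of `lipConst` are nonnegative. -/
theorem lipConst_term_nonneg (p : Params n) (i : Fin n) :
    0 ≤ 2 * p.absCoupling i / |p.D i| + (|p.D i| + 2 * p.absCoupling i) / |p.M i| := by
  have := p.absCoupling_nonneg i
  positivity

/-- `1 ≤ lipConst`. -/
theorem one_le_lipConst (p : Params n) : 1 ≤ p.lipConst := by
  have := Finset.sum_nonneg fun i (_ : i ∈ (univ : Finset (Fin n))) => p.lipConst_term_nonneg i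
  unfold lipConst
  linarith

/-- Each per-bus velocity constant is below `lipConst`. -/
theorem velConst_le_lipConst (p : Params n) (i : Fin n) :
    2 * p.absCoupling i / |p.D i| ≤ p.lipConst := by
  have hle := Finset.single_le_sum (f := fun i => 2 * p.absCoupling i / |p.D i|
      + (|p.D i| + 2 * p.absCoupling i) / |p.M i|) (fun i _ => p.lipConst_term_nonneg i)
    (Finset.mem_univ i)
  have h2 : 0 ≤ (|p.D i| + 2 * p.absCoupling i) / |p.M i| := by
    have := p.absCoupling_nonneg i; positivity
  unfold lipConst
  linarith

/-- Each per-bus acceleration constant is below `lipConst`. -/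
theorem accConst_le_lipConst (p : Params n) (i : Fin n) :
    (|p.D i| + 2 * p.absCoupling i) / |p.M i| ≤ p.lipConst := by
  have hle := Finset.single_le_sum (f := fun i => 2 * p.absCoupling i / |p.D i|
      + (|p.D i| + 2 * p.absCoupling i) / |p.M i|) (fun i _ => p.lipConst_term_nonneg i)
    (Finset.mem_univ i)
  have h2 : 0 ≤ 2 * p.absCoupling i / |p.D i| := by
    have := p.absCoupling_nonneg i; positivity
  unfold lipConst
  linarith

/-- Velocity components are `lipConst`-Lipschitz. -/
theorem abs_vel_sub_vel_le (p : Params n) (z z' : (Fin n → ℝ) × (Fin n → ℝ)) (i : Fin n) :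
    |p.vel z i - p.vel z' i| ≤ p.lipConst * dist z z' := by
  have hd : 0 ≤ dist z z' := dist_nonneg
  have h1 : dist z.1 z'.1 ≤ dist z z' := by rw [Prod.dist_eq]; exact le_max_left _ _
  have h2 : dist z.2 z'.2 ≤ dist z z' := by rw [Prod.dist_eq]; exact le_max_right _ _
  by_cases hi : i ∈ p.gen
  · rw [vel_of_mem hi, vel_of_mem hi]
    have h : |z.2 i - z'.2 i| ≤ dist z z' := by
      rw [← Real.dist_eq]; exact (dist_le_pi_dist z.2 z'.2 i).trans h2
    calc |z.2 i - z'.2 i| ≤ dist z z' := h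
      _ = 1 * dist z z' := (one_mul _).symm
      _ ≤ p.lipConst * dist z z' := mul_le_mul_of_nonneg_right p.one_le_lipConst hd
  · rw [vel_of_not_mem hi, vel_of_not_mem hi, ← sub_div, abs_div,
      show p.P0 i - p.pe z.1 i - (p.P0 i - p.pe z'.1 i) = -(p.pe z.1 i - p.pe z'.1 i) by ring,
      abs_neg]
    have hpe := (p.abs_pe_sub_pe_le z.1 z'.1 i).trans
      (mul_le_mul_of_nonneg_left h1 (by have := p.absCoupling_nonneg i; positivity))
    calc |p.pe z.1 i - p.pe z'.1 i| / |p.D i|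
        ≤ 2 * p.absCoupling i * dist z z' / |p.D i| :=
          div_le_div_of_nonneg_right hpe (abs_nonneg _)
      _ = (2 * p.absCoupling i / |p.D i|) * dist z z' := by ring
      _ ≤ p.lipConst * dist z z' := mul_le_mul_of_nonneg_right (p.velConst_le_lipConst i) hd

/-- Acceleration components are `lipConst`-Lipschitz. -/
theorem abs_acc_sub_acc_le (p : Params n) (z z' : (Fin n → ℝ) × (Fin n → ℝ)) (i : Fin n) :
    |p.acc z i - p.acc z' i| ≤ p.lipConst * dist z z' := by
  have hd : 0 ≤ dist z z' := dist_nonneg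
  have h1 : dist z.1 z'.1 ≤ dist z z' := by rw [Prod.dist_eq]; exact le_max_left _ _
  have h2 : dist z.2 z'.2 ≤ dist z z' := by rw [Prod.dist_eq]; exact le_max_right _ _
  by_cases hi : i ∈ p.gen
  · rw [acc_of_mem hi, acc_of_mem hi, ← sub_div, abs_div]
    have hω : |z.2 i - z'.2 i| ≤ dist z z' := by
      rw [← Real.dist_eq]; exact (dist_le_pi_dist z.2 z'.2 i).trans h2
    have hpe := (p.abs_pe_sub_pe_le z.1 z'.1 i).trans
      (mul_le_mul_of_nonneg_left h1 (by have := p.absCoupling_nonneg i; positivity))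
    have hnum : |p.P0 i - p.D i * z.2 i - p.pe z.1 i - (p.P0 i - p.D i * z'.2 i - p.pe z'.1 i)|
        ≤ (|p.D i| + 2 * p.absCoupling i) * dist z z' := by
      rw [show p.P0 i - p.D i * z.2 i - p.pe z.1 i - (p.P0 i - p.D i * z'.2 i - p.pe z'.1 i)
        = -(p.D i * (z.2 i - z'.2 i)) + -(p.pe z.1 i - p.pe z'.1 i) by ring]
      refine (abs_add_le _ _).trans ?_
      rw [abs_neg, abs_neg, abs_mul, add_mul]
      exact add_le_add (mul_le_mul_of_nonneg_left hω (abs_nonneg _)) hpe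
    calc |p.P0 i - p.D i * z.2 i - p.pe z.1 i - (p.P0 i - p.D i * z'.2 i - p.pe z'.1 i)| / |p.M i|
        ≤ (|p.D i| + 2 * p.absCoupling i) * dist z z' / |p.M i| :=
          div_le_div_of_nonneg_right hnum (abs_nonneg _)
      _ = ((|p.D i| + 2 * p.absCoupling i) / |p.M i|) * dist z z' := by ring
      _ ≤ p.lipConst * dist z z' := mul_le_mul_of_nonneg_right (p.accConst_le_lipConst i) hd
  · rw [acc_of_not_mem hi, acc_of_not_mem hi, sub_self, abs_zero]
    exact mul_nonneg (zero_le_one.trans p.one_le_lipConst) hd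

/-- **The phase field is globally Lipschitz** (sup metric): `dist(F z, F z') ≤ lipConst·dist(z, z')`. -/
theorem dist_phaseField_le (p : Params n) (z z' : (Fin n → ℝ) × (Fin n → ℝ)) :
    dist (p.phaseField z) (p.phaseField z') ≤ p.lipConst * dist z z' := by
  have hK : 0 ≤ p.lipConst * dist z z' := mul_nonneg (zero_le_one.trans p.one_le_lipConst) dist_nonneg
  rw [Prod.dist_eq, max_le_iff, phaseField_fst, phaseField_fst, phaseField_snd, phaseField_snd,
    dist_pi_le_iff hK, dist_pi_le_iff hK]
  exact ⟨fun i => by rw [Real.dist_eq]; exact p.abs_vel_sub_vel_le z z' i,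
    fun i => by rw [Real.dist_eq]; exact p.abs_acc_sub_acc_le z z' i⟩

/-- **The phase field is globally Lipschitz** (as a `LipschitzWith` fact). -/
theorem lipschitzWith_phaseField (p : Params n) :
    LipschitzWith (Real.toNNReal p.lipConst) p.phaseField :=
  LipschitzWith.of_dist_le' fun z z' => p.dist_phaseField_le z z'

/-! ## Global existence of phase solutions -/

/-- **Through every phase point passes a solution of the structure-preserving model defined for all
times**: for every `y` there is `X : ℝ → (Fin n → ℝ) × (Fin n → ℝ)` with `X 0 = y` and
`X'(t) = F(X t)` for every `t ∈ ℝ` (MODEL MV-3 as the field `p.phaseField`; global Lipschitz field ⇒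
no finite-time blow-up). [cite: Hartman2002, Ch. III Thm. 5.1 with Remark 1] -/
theorem exists_phaseSolution (p : Params n) (y : (Fin n → ℝ) × (Fin n → ℝ)) :
    ∃ X : ℝ → (Fin n → ℝ) × (Fin n → ℝ), X 0 = y ∧ ∀ t, HasDerivAt X (p.phaseField (X t)) t :=
  Literature.Analysis.ODE.exists_solution_real_of_lipschitz p.lipschitzWith_phaseField y

/-- **Global existence in the tree's solution convention**: from every phase point `y` there is an
`X` with `X 0 = y` solving `X' = F(X)` on every `[0, T]` (`HasDerivWithinAt … (Icc 0 T)`), the shape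
the region-of-attraction theorems (`Lyapunov/StructurePreservingRoa`,
`Models/StructurePreservingLurieRoa`) quantify over — so those a-priori sentences are never
vacuous. [cite: Hartman2002, Ch. III Thm. 5.1 with Remark 1] -/
theorem exists_phaseSolution_Icc (p : Params n) (y : (Fin n → ℝ) × (Fin n → ℝ)) :
    ∃ X : ℝ → (Fin n → ℝ) × (Fin n → ℝ), X 0 = y ∧
      ∀ T : ℝ, ∀ t ∈ Icc 0 T, HasDerivWithinAt X (p.phaseField (X t)) (Icc 0 T) t := by
  obtain ⟨X, h0, hX⟩ := p.exists_phaseSolution y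
  exact ⟨X, h0, fun T t _ => (hX t).hasDerivWithinAt⟩

/-- **Uniqueness of phase solutions** (global Lipschitz field, Grönwall): two solutions of MV-3 on
`[0, T]` (tree convention) with the same initial phase point coincide on `[0, T]`. With
`exists_phaseSolution_Icc`: through every phase point there is EXACTLY ONE trajectory, so the
a-priori region-of-attraction sentences speak about «the» solution. [cite: Hartman2002, Ch. III Thm. 5.1 with Remark 1] -/
theorem phaseSolution_unique (p : Params n) {X Y : ℝ → (Fin n → ℝ) × (Fin n → ℝ)} {T : ℝ}
    (hX : ∀ t ∈ Icc 0 T, HasDerivWithinAt X (p.phaseField (X t)) (Icc 0 T) t)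
    (hY : ∀ t ∈ Icc 0 T, HasDerivWithinAt Y (p.phaseField (Y t)) (Icc 0 T) t)
    (h0 : X 0 = Y 0) : EqOn X Y (Icc 0 T) := by
  have hder : ∀ {Z : ℝ → (Fin n → ℝ) × (Fin n → ℝ)},
      (∀ t ∈ Icc 0 T, HasDerivWithinAt Z (p.phaseField (Z t)) (Icc 0 T) t) →
      ∀ t ∈ Ico 0 T, HasDerivWithinAt Z (p.phaseField (Z t)) (Ici t) t := by
    intro Z hZ t ht
    exact (hZ t (Ico_subset_Icc_self ht)).mono_of_mem_nhdsWithin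
      (Filter.mem_of_superset (Icc_mem_nhdsGE ht.2) (Icc_subset_Icc ht.1 le_rfl))
  exact ODE_solution_unique_of_mem_Icc_right (v := fun _ => p.phaseField) (s := fun _ => univ)
    (fun _ _ => p.lipschitzWith_phaseField.lipschitzOnWith)
    (fun t ht => (hX t ht).continuousWithinAt) (hder hX) (fun _ _ => mem_univ _)
    (fun t ht => (hY t ht).continuousWithinAt) (hder hY) (fun _ _ => mem_univ _) h0

end Summit.Ventures.GridStability.Models.StructurePreserving.Params

end
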